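import Summits.Parity.GeneralizedHardyLittlewood.Theorems.LeeYangFibresRelativeDimOneTypeRigidityCells
import Summits.Parity.GeneralizedHardyLittlewood.Theorems.LeeYangFibresRelativeDimOneTypeRigidityLocal
import Summits.Parity.GeneralizedHardyLittlewood.Theorems.LeeYangFibresRelativeDimOneTypeRigiditySums
import Summits.Parity.GeneralizedHardyLittlewood.Theorems.LeeYangFibresRelativeDimOneTypeDataE
import Summits.Parity.GeneralizedHardyLittlewood.Theorems.LeeYangFibresRelativeDimOneSingularTail
import Summits.Parity.GeneralizedHardyLittlewood.Theorems.LeeYangFibresRelativeDimOneSplitTranslation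
import HarnessLib

/-!
# Route `LeeYangFibres`, crux `RelativeDimOne` (stmt-Parity-14113), line `gallagher-backwards-split` (RESHAPED,
# type-conditioned split): the registered stub `stub_typeRigidity : TypeRigidity`

TYPE RIGIDITY (vocabulary `LeeYangFibresRelativeDimOneTypeDefs`): for a type-invariant spectrum `e` with
Hardy–Littlewood decay `|e q b| ≤ C ∏_{p∣q}(|β_p(a,b) − 1| + t²/p²)`, a non-degenerate target `b₀` of height `≤ LN`,
`w = ⌊log₄N⌋/D`, eventually in `N` and for every level `Q`:
(R1) `|sfBand Q e b₀ − smoothBand Q w e b₀| ≤ κ G_w(a,b₀)`,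
(R2) `|condSum Q w a b₀ e − smoothBand Q w e b₀| ≤ κ G_w(a,b₀)`,
(R3) `Σ_{q ≤ Q sqfree} condAvg_q |e q| ≤ (1+κ) C G_w(a,b₀)`.

Proof (the `t`-tuple version of the landed pair theorem `pairRigidityWeighted`, p112112). Split every squarefree `q`
as `q₁ q₂`, `q₁ = gcd(q, ∏_{p≤w} p)` smooth, `q₂` rough (`rough_decomp`).
* Smooth moduli are FROZEN on the cell: `condAvg_q(e q) = e q b₀` (`RigidityProof.condAvg_eq_of_smooth`), so (R2),
  (R3) only see the moduli with `q₂ ≠ 1`.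
* For those, the cell is `typeCell q₁ × (ℤ/q₂)^t` (`RigidityProof.condAvg_factor`, CRT) and the weight is
  multiplicative, so `condAvg_q |e q| ≤ C · wprod q₁ b₀ · ∏_{p∣q₂} m_p` with the MEAN WEIGHT
  `m_p = p^{-t} Σ_{v} wt(a,v,p) ≤ 7t⁴/p²` (`rigidity_meanWt_le`).
* Summing, `Σ_{q₁ ∣ P} wprod q₁ b₀ = ∏_{p≤w}(1 + wt) = G_w` (`rigidity_sum_divisors_primorial`) and
  `Σ_{q₂ rough} ∏_{p∣q₂} m_p ≤ ∏_{w<p≤Q}(1 + 7t⁴/p²) − 1 ≤ 2 · 7t⁴/w`.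
* (R1): the dropped moduli have a rough part; `Σ ≤ C G_w (∏_{w<p≤Q}(1 + wt(b₀,p)) − 1)` and
  `Σ_{w<p≤Q} wt(b₀,p) = Σ|β_p(b₀) − 1| + Σ t²/p²` is small by the landed uniform tail
  `SingularTailProof.sum_abs_localFactor_sub_one_le` (the `≤ t² log(2L'²N)/log w` rough primes dividing a
  cross-discriminant cost `4t/p` each, generic ones `t²/p²`).
* `rigidity_threshold` makes all of this `≤ s = min 1 (κ/(2C+2))` once `N ≥ N₀(t, L, D, C, κ)`.
-/

noncomputable section

open scoped BigOperators Classical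
open Finset Literature.NumberTheory.Sieve
open Summit.Parity.GeneralizedHardyLittlewood.Cruxes.RelativeDimOne.GallagherBackwardsSplit
open Summit.Parity.GeneralizedHardyLittlewood.Cruxes.RelativeDimOne.TranslateAmplification

namespace Summit.Parity.GeneralizedHardyLittlewood.Cruxes.RelativeDimOne.TypeSplit

namespace RigidityProof

open TypeDataProof

variable {t : ℕ}

/-! ### The per-modulus bound for moduli with a rough part -/

/-- The rough part `q / gcd(q, ∏_{p≤w} p)` of a squarefree `q ≥ 1` is positive. -/
theorem rough_part_pos (w : ℕ) {q : ℕ} (hq : 1 ≤ q) (hsq : Squarefree q) : 0 < q / Nat.gcd q (primorial w) := by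
  obtain ⟨hqq, -⟩ := rough_decomp w hq hsq
  rcases Nat.eq_zero_or_pos (q / Nat.gcd q (primorial w)) with h0 | h0
  · exfalso; rw [h0, mul_zero] at hqq; omega
  · exact h0

/-- DECAY × MULTIPLICATIVITY: `|e q b| ≤ C · wprod q₁ b · wprod q₂ b`. -/
theorem abs_le_of_decay_split (w : ℕ) {C : ℝ} {a : Fin t → ℤ} {e : ℕ → (Fin t → ℤ) → ℝ} (hdec : HasDecay C a e)
    {q : ℕ} (hq : 1 ≤ q) (hsq : Squarefree q) (b : Fin t → ℤ) :
    |e q b| ≤ C * (wprod (Nat.gcd q (primorial w)) a b * wprod (q / Nat.gcd q (primorial w)) a b) := by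
  obtain ⟨hqq, hcop, -⟩ := rough_decomp w hq hsq
  have hq₁0 : 0 < Nat.gcd q (primorial w) := Nat.gcd_pos_of_pos_left _ hq
  have := hdec q hsq b
  rw [hqq, wprod_mul_of_coprime a b hq₁0 (rough_part_pos w hq hsq) hcop, ← hqq] at this
  exact this

/-- For a squarefree modulus `q = q₁ q₂` (`q₁ = gcd(q, ∏_{p≤w} p)`), a type-invariant spectrum with decay constant `C`
and `w` beyond `L` and `2t`: `condAvg_q |e q| ≤ C · wprod q₁ b₀ · ∏_{p ∣ q₂} (7t⁴/p²)`. -/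
theorem condAvg_abs_le_of_decay {L w : ℕ} {C : ℝ} (hC : 0 ≤ C) {a : Fin t → ℤ}
    (ha : ∀ i, a i ≠ 0 ∧ |a i| ≤ L) (hLw : L < w) (htw : 2 * t ≤ w)
    {e : ℕ → (Fin t → ℤ) → ℝ} (hdec : HasDecay C a e) {q : ℕ} (hq : 1 ≤ q) (hsq : Squarefree q)
    (b₀ : Fin t → ℤ) :
    condAvg q w a b₀ (fun b => |e q b|) ≤
      C * wprod (Nat.gcd q (primorial w)) a b₀ *
        ∏ p ∈ (q / Nat.gcd q (primorial w)).primeFactors, (7 * (t : ℝ) ^ 4 / (p : ℝ) ^ 2) := by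
  obtain ⟨-, -, -, hsq₂, hrough, -, -⟩ := rough_decomp w hq hsq
  have hq₂0 : 0 < q / Nat.gcd q (primorial w) := rough_part_pos w hq hsq
  -- step 1: decay and multiplicativity
  have h1 : condAvg q w a b₀ (fun b => |e q b|) ≤
      condAvg q w a b₀ (fun b => C * (wprod (Nat.gcd q (primorial w)) a b *
        wprod (q / Nat.gcd q (primorial w)) a b)) :=
    condAvg_mono q w a b₀ fun b => abs_le_of_decay_split w hdec hq hsq b
  rw [condAvg_const_mul] at h1
  -- step 2: the CRT factorisation
  have h2 := condAvg_factor w hq hsq a b₀ (fun b => wprod (Nat.gcd q (primorial w)) a b)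
    (fun b => wprod (q / Nat.gcd q (primorial w)) a b)
    (fun b hb => wprod_eq_of_types a hb) (fun b b' hbb' => wprod_congr_mod a hbb')
  -- step 3: the mean weight over `(ℤ/q₂)^t`
  have hS : ∀ p ∈ (q / Nat.gcd q (primorial w)).primeFactors, p.Prime := fun p hp =>
    Nat.prime_of_mem_primeFactors hp
  have hq₂prod : ∏ p ∈ (q / Nat.gcd q (primorial w)).primeFactors, p = q / Nat.gcd q (primorial w) :=
    Nat.prod_primeFactors_of_squarefree hsq₂
  have h3 : ∑ y ∈ Fintype.piFinset (fun _ : Fin t => Finset.range (q / Nat.gcd q (primorial w))),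
        wprod (q / Nat.gcd q (primorial w)) a (fun i => (y i : ℤ)) =
      ∏ p ∈ (q / Nat.gcd q (primorial w)).primeFactors,
        ∑ x ∈ Fintype.piFinset (fun _ : Fin t => Finset.range p), wt a (fun i => (x i : ℤ)) p := by
    have := sum_piFinset_prod_wt a (q / Nat.gcd q (primorial w)).primeFactors hS
    rw [hq₂prod] at this
    exact this
  have h4 : ∏ p ∈ (q / Nat.gcd q (primorial w)).primeFactors,
        ∑ x ∈ Fintype.piFinset (fun _ : Fin t => Finset.range p), wt a (fun i => (x i : ℤ)) p ≤
      ∏ p ∈ (q / Nat.gcd q (primorial w)).primeFactors, (7 * (t : ℝ) ^ 4 * (p : ℝ) ^ t / (p : ℝ) ^ 2) := by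
    refine Finset.prod_le_prod (fun p _ => Finset.sum_nonneg fun x _ => wt_nonneg _ _ _) fun p hp => ?_
    have hpw : w < p := hrough p hp
    exact rigidity_meanWt_le L a ha p (hS p hp) (lt_trans hLw hpw) (le_trans htw hpw.le)
  have h5 : ∏ p ∈ (q / Nat.gcd q (primorial w)).primeFactors, (7 * (t : ℝ) ^ 4 * (p : ℝ) ^ t / (p : ℝ) ^ 2) =
      (((q / Nat.gcd q (primorial w) : ℕ)) : ℝ) ^ t *
        ∏ p ∈ (q / Nat.gcd q (primorial w)).primeFactors, (7 * (t : ℝ) ^ 4 / (p : ℝ) ^ 2) := by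
    have e1 : (((q / Nat.gcd q (primorial w) : ℕ)) : ℝ) ^ t =
        ∏ p ∈ (q / Nat.gcd q (primorial w)).primeFactors, (p : ℝ) ^ t := by
      rw [Finset.prod_pow, ← Nat.cast_prod, hq₂prod]
    rw [e1, ← Finset.prod_mul_distrib]
    exact Finset.prod_congr rfl fun p _ => by ring
  have hq₂t : (0 : ℝ) < (((q / Nat.gcd q (primorial w) : ℕ)) : ℝ) ^ t := by positivity
  have h6 : (∑ y ∈ Fintype.piFinset (fun _ : Fin t => Finset.range (q / Nat.gcd q (primorial w))),
        wprod (q / Nat.gcd q (primorial w)) a (fun i => (y i : ℤ))) /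
      ((((q / Nat.gcd q (primorial w) : ℕ)) : ℝ) ^ t) ≤
      ∏ p ∈ (q / Nat.gcd q (primorial w)).primeFactors, (7 * (t : ℝ) ^ 4 / (p : ℝ) ^ 2) := by
    rw [div_le_iff₀ hq₂t, h3, mul_comm]
    exact h4.trans h5.le
  calc condAvg q w a b₀ (fun b => |e q b|)
      ≤ C * condAvg q w a b₀ (fun b => wprod (Nat.gcd q (primorial w)) a b *
          wprod (q / Nat.gcd q (primorial w)) a b) := h1
    _ = C * (wprod (Nat.gcd q (primorial w)) a b₀ *
          ((∑ y ∈ Fintype.piFinset (fun _ : Fin t => Finset.range (q / Nat.gcd q (primorial w))),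
            wprod (q / Nat.gcd q (primorial w)) a (fun i => (y i : ℤ))) /
            ((((q / Nat.gcd q (primorial w) : ℕ)) : ℝ) ^ t))) := by rw [h2]
    _ ≤ C * (wprod (Nat.gcd q (primorial w)) a b₀ *
          ∏ p ∈ (q / Nat.gcd q (primorial w)).primeFactors, (7 * (t : ℝ) ^ 4 / (p : ℝ) ^ 2)) :=
        mul_le_mul_of_nonneg_left (mul_le_mul_of_nonneg_left h6 (wprod_nonneg _ _ _)) hC
    _ = _ := by ring

/-! ### Bookkeeping: smooth moduli divide the primorial; sizes; the three splits -/

/-- A `w`-smooth squarefree `q ≥ 1` divides `∏_{p ≤ w} p`. -/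
theorem dvd_primorial_of_smooth {w q : ℕ} (hq : 1 ≤ q) (hsq : Squarefree q)
    (hsm : ∀ p ∈ q.primeFactors, p ≤ w) : q ∣ primorial w := by
  obtain ⟨hqq, -, hdvd, -, -, -, hiff⟩ := rough_decomp w hq hsq
  rw [hiff.1 hsm, mul_one] at hqq
  rw [hqq]
  exact hdvd

/-- `‖sys a b₀‖_N ≤ 2tL` when `|a_i| ≤ L`, `|b₀,i| ≤ LN`, `N ≥ 1`. -/
theorem affLinSize_sys_le {L N : ℕ} (hN : 1 ≤ N) {a b₀ : Fin t → ℤ} (ha : ∀ i, a i ≠ 0 ∧ |a i| ≤ L)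
    (hb : ∀ i, |b₀ i| ≤ L * N) : affLinSize (sys a b₀) N ≤ ((2 * t * L : ℕ) : ℝ) := by
  rw [affLinSize_sys]
  have hNr : (0 : ℝ) < N := by exact_mod_cast hN
  have h1 : ∑ i, |(a i : ℝ)| ≤ t * L := by
    calc ∑ i, |(a i : ℝ)| ≤ ∑ _i : Fin t, (L : ℝ) := Finset.sum_le_sum fun i _ => by
            have := (ha i).2
            rw [← Int.cast_abs]
            exact_mod_cast this
      _ = t * L := by rw [Finset.sum_const, Finset.card_univ, Fintype.card_fin, nsmul_eq_mul]
  have h2 : ∑ i, |(b₀ i : ℝ) / N| ≤ t * L := by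
    calc ∑ i, |(b₀ i : ℝ) / N| ≤ ∑ _i : Fin t, (L : ℝ) := Finset.sum_le_sum fun i _ => by
            rw [abs_div, abs_of_pos hNr, div_le_iff₀ hNr, ← Int.cast_abs]
            have := hb i
            exact_mod_cast this
      _ = t * L := by rw [Finset.sum_const, Finset.card_univ, Fintype.card_fin, nsmul_eq_mul]
  push_cast
  linarith

/-- (R1) split: the band sum minus its smooth part is the sum over the moduli with a rough prime factor. -/
theorem sfBand_sub_smoothBand (Q w : ℕ) (e : ℕ → (Fin t → ℤ) → ℝ) (b : Fin t → ℤ) :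
    sfBand Q e b - smoothBand Q w e b =
      ∑ q ∈ ((Finset.Icc 1 Q).filter Squarefree).filter (fun q => ¬ ∀ p ∈ q.primeFactors, p ≤ w), e q b := by
  unfold sfBand smoothBand
  rw [← Finset.sum_filter_add_sum_filter_not ((Finset.Icc 1 Q).filter Squarefree)
    (fun q => ∀ p ∈ q.primeFactors, p ≤ w)]
  ring

/-- (R2) split: the conditioned density minus the smooth part is the sum of the conditioned averages over the moduli
with a rough prime factor (the smooth moduli are frozen). -/
theorem condSum_sub_smoothBand (Q w : ℕ) {a : Fin t → ℤ} {e : ℕ → (Fin t → ℤ) → ℝ} (he : TypeInvariant a e)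
    (b₀ : Fin t → ℤ) :
    condSum Q w a b₀ e - smoothBand Q w e b₀ =
      ∑ q ∈ ((Finset.Icc 1 Q).filter Squarefree).filter (fun q => ¬ ∀ p ∈ q.primeFactors, p ≤ w),
        condAvg q w a b₀ (e q) := by
  unfold condSum smoothBand
  rw [← Finset.sum_filter_add_sum_filter_not ((Finset.Icc 1 Q).filter Squarefree)
    (fun q => ∀ p ∈ q.primeFactors, p ≤ w)]
  have hsm : ∑ q ∈ ((Finset.Icc 1 Q).filter Squarefree).filter (fun q => ∀ p ∈ q.primeFactors, p ≤ w),
      condAvg q w a b₀ (e q) =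
      ∑ q ∈ ((Finset.Icc 1 Q).filter Squarefree).filter (fun q => ∀ p ∈ q.primeFactors, p ≤ w), e q b₀ := by
    refine Finset.sum_congr rfl fun q hq => ?_
    rw [Finset.mem_filter, Finset.mem_filter, Finset.mem_Icc] at hq
    exact condAvg_eq_of_smooth hq.1.1.1 hq.1.2 hq.2 he b₀
  rw [hsm]
  ring

/-- (R3) split. -/
theorem sum_condAvg_abs_split (Q w : ℕ) {a : Fin t → ℤ} {e : ℕ → (Fin t → ℤ) → ℝ} (he : TypeInvariant a e)
    (b₀ : Fin t → ℤ) :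
    ∑ q ∈ (Finset.Icc 1 Q).filter Squarefree, condAvg q w a b₀ (fun b => |e q b|) =
      ∑ q ∈ ((Finset.Icc 1 Q).filter Squarefree).filter (fun q => ∀ p ∈ q.primeFactors, p ≤ w), |e q b₀| +
        ∑ q ∈ ((Finset.Icc 1 Q).filter Squarefree).filter (fun q => ¬ ∀ p ∈ q.primeFactors, p ≤ w),
          condAvg q w a b₀ (fun b => |e q b|) := by
  rw [← Finset.sum_filter_add_sum_filter_not ((Finset.Icc 1 Q).filter Squarefree)
    (fun q => ∀ p ∈ q.primeFactors, p ≤ w), sum_smooth_condAvg_abs he b₀]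

/-! ### The main estimate -/

/-- **TYPE RIGIDITY** (R1), (R2), (R3). -/
theorem typeRigidity_holds : TypeRigidity := by
  intro t L D C κ ht hD hC hκ
  -- constants
  have hK0 : (0 : ℝ) ≤ 7 * (t : ℝ) ^ 4 := by positivity
  have hs0 : 0 < min 1 (κ / (2 * C + 2)) := lt_min one_pos (div_pos hκ (by linarith))
  have hs1 : min 1 (κ / (2 * C + 2)) ≤ 1 := min_le_left _ _
  have hsκ : min 1 (κ / (2 * C + 2)) * (2 * C + 2) ≤ κ := by
    have := min_le_right 1 (κ / (2 * C + 2))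
    rwa [le_div_iff₀ (by linarith)] at this
  obtain ⟨N₀, hN₀⟩ := rigidity_threshold t (2 * t * L) D (7 * (t : ℝ) ^ 4) (min 1 (κ / (2 * C + 2))) hD hK0 hs0
  refine ⟨max N₀ 1, fun N hN Q a ha e hinv hdec b₀ hb₀ hnd => ?_⟩
  obtain ⟨hLw, htw, h2w, hσ, hKw⟩ := hN₀ N (le_of_max_le_left hN)
  have hN1 : 1 ≤ N := le_of_max_le_right hN
  -- abbreviations (only real numbers and naturals)
  set s : ℝ := min 1 (κ / (2 * C + 2)) with hs
  set K : ℝ := 7 * (t : ℝ) ^ 4 with hK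
  set w : ℕ := wlev D N with hw
  have hLw' : L < w := by
    refine lt_of_le_of_lt ?_ hLw
    calc L = 1 * L := (one_mul L).symm
      _ ≤ 2 * t * L := Nat.mul_le_mul_right L (by omega)
  have hw1 : 1 ≤ w := by omega
  have hG : gscale w a b₀ = ∑ d ∈ (primorial w).divisors, wprod d a b₀ := by
    unfold gscale wprod
    rw [rigidity_sum_divisors_primorial w (wt a b₀)]
  have hG1 : 1 ≤ gscale w a b₀ := EndgameProof.one_le_gscale w a b₀
  have hG0 : 0 ≤ gscale w a b₀ := le_trans zero_le_one hG1
  have hTprime : ∀ p ∈ Nat.primesLE Q \ Nat.primesLE w, p.Prime := fun p hp =>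
    (Nat.mem_primesLE.1 (Finset.mem_sdiff.1 hp).1).2
  have hRspec : ∀ r ∈ ((Finset.Icc 2 Q).filter Squarefree).filter (fun r => ∀ p ∈ r.primeFactors, w < p),
      Squarefree r ∧ r ≠ 1 ∧ r.primeFactors ⊆ Nat.primesLE Q \ Nat.primesLE w := fun r hr =>
    roughFinset_spec Q w hr
  -- (i) the rough tail of the MEAN weights
  have hmeanTail : ∑ r ∈ ((Finset.Icc 2 Q).filter Squarefree).filter (fun r => ∀ p ∈ r.primeFactors, w < p),
      ∏ p ∈ r.primeFactors, (K / (p : ℝ) ^ 2) ≤ 2 * s := by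
    have h1 := sum_rough_le_prod_sub_one (Nat.primesLE Q \ Nat.primesLE w)
      (((Finset.Icc 2 Q).filter Squarefree).filter (fun r => ∀ p ∈ r.primeFactors, w < p))
      (fun p => K / (p : ℝ) ^ 2) hTprime (fun p => by positivity) hRspec
    refine h1.trans (prod_one_add_sub_one_le (Nat.primesLE Q \ Nat.primesLE w) (fun p => K / (p : ℝ) ^ 2)
      (fun p => by positivity) ?_ hs1)
    calc ∑ p ∈ Nat.primesLE Q \ Nat.primesLE w, K / (p : ℝ) ^ 2
        = K * ∑ p ∈ Nat.primesLE Q \ Nat.primesLE w, 1 / (p : ℝ) ^ 2 := by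
          rw [Finset.mul_sum]; exact Finset.sum_congr rfl fun p _ => by ring
      _ ≤ K * (1 / w) := mul_le_mul_of_nonneg_left (sum_inv_sq_primes_tail_le w Q hw1) hK0
      _ = K / w := by ring
      _ ≤ s := hKw
  -- (ii) the rough tail of the TARGET's weights
  have hwtTail : ∑ r ∈ ((Finset.Icc 2 Q).filter Squarefree).filter (fun r => ∀ p ∈ r.primeFactors, w < p),
      wprod r a b₀ ≤ 2 * s := by
    have h1 := sum_rough_le_prod_sub_one (Nat.primesLE Q \ Nat.primesLE w)
      (((Finset.Icc 2 Q).filter Squarefree).filter (fun r => ∀ p ∈ r.primeFactors, w < p))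
      (wt a b₀) hTprime (fun p => wt_nonneg a b₀ p) hRspec
    refine h1.trans (prod_one_add_sub_one_le (Nat.primesLE Q \ Nat.primesLE w) (wt a b₀)
      (fun p => wt_nonneg a b₀ p) ?_ hs1)
    have hsplit : ∑ p ∈ Nat.primesLE Q \ Nat.primesLE w, wt a b₀ p =
        ∑ p ∈ Nat.primesLE Q \ Nat.primesLE w, |localFactor (sys a b₀) p - 1| +
          (t : ℝ) ^ 2 * ∑ p ∈ Nat.primesLE Q \ Nat.primesLE w, 1 / (p : ℝ) ^ 2 := by
      unfold wt
      rw [Finset.sum_add_distrib, Finset.mul_sum]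
      congr 1
      exact Finset.sum_congr rfl fun p _ => by ring
    rw [hsplit]
    have hA := SingularTailProof.sum_abs_localFactor_sub_one_le (sys a b₀) hnd (N := N) (L := 2 * t * L)
      (y := w) hN1 (affLinSize_sys_le hN1 ha hb₀) h2w hLw.le htw Q
    have hB : (t : ℝ) ^ 2 * ∑ p ∈ Nat.primesLE Q \ Nat.primesLE w, 1 / (p : ℝ) ^ 2 ≤ (t : ℝ) ^ 2 / w := by
      calc (t : ℝ) ^ 2 * ∑ p ∈ Nat.primesLE Q \ Nat.primesLE w, 1 / (p : ℝ) ^ 2 ≤ (t : ℝ) ^ 2 * (1 / w) :=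
            mul_le_mul_of_nonneg_left (sum_inv_sq_primes_tail_le w Q hw1) (by positivity)
        _ = (t : ℝ) ^ 2 / w := by ring
    linarith
  -- (iii) the non-smooth sums factor through `G_w`
  have hSn_mean : ∑ q ∈ ((Finset.Icc 1 Q).filter Squarefree).filter (fun q => ¬ ∀ p ∈ q.primeFactors, p ≤ w),
      wprod (Nat.gcd q (primorial w)) a b₀ *
        ∏ p ∈ (q / Nat.gcd q (primorial w)).primeFactors, (K / (p : ℝ) ^ 2) ≤ gscale w a b₀ * (2 * s) := by
    have h1 := sum_nonsmooth_le_mul Q w (fun d => wprod d a b₀)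
      (fun r => ∏ p ∈ r.primeFactors, (K / (p : ℝ) ^ 2)) (fun d => wprod_nonneg d a b₀)
      (fun r => Finset.prod_nonneg fun p _ => by positivity)
    refine le_trans h1 ?_
    show (∑ d ∈ (primorial w).divisors, wprod d a b₀) *
        (∑ r ∈ ((Finset.Icc 2 Q).filter Squarefree).filter (fun r => ∀ p ∈ r.primeFactors, w < p),
          ∏ p ∈ r.primeFactors, (K / (p : ℝ) ^ 2)) ≤ gscale w a b₀ * (2 * s)
    rw [← hG]
    exact mul_le_mul_of_nonneg_left hmeanTail hG0
  have hSn_wt : ∑ q ∈ ((Finset.Icc 1 Q).filter Squarefree).filter (fun q => ¬ ∀ p ∈ q.primeFactors, p ≤ w),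
      wprod (Nat.gcd q (primorial w)) a b₀ * wprod (q / Nat.gcd q (primorial w)) a b₀ ≤
        gscale w a b₀ * (2 * s) := by
    have h1 := sum_nonsmooth_le_mul Q w (fun d => wprod d a b₀) (fun r => wprod r a b₀)
      (fun d => wprod_nonneg d a b₀) (fun r => wprod_nonneg r a b₀)
    refine le_trans h1 ?_
    show (∑ d ∈ (primorial w).divisors, wprod d a b₀) *
        (∑ r ∈ ((Finset.Icc 2 Q).filter Squarefree).filter (fun r => ∀ p ∈ r.primeFactors, w < p),
          wprod r a b₀) ≤ gscale w a b₀ * (2 * s)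
    rw [← hG]
    exact mul_le_mul_of_nonneg_left hwtTail hG0
  have hmemS : ∀ q ∈ ((Finset.Icc 1 Q).filter Squarefree).filter (fun q => ¬ ∀ p ∈ q.primeFactors, p ≤ w),
      1 ≤ q ∧ Squarefree q := fun q hq => by
    rw [Finset.mem_filter, Finset.mem_filter, Finset.mem_Icc] at hq
    exact ⟨hq.1.1.1, hq.1.2⟩
  -- the three sums over the non-smooth moduli
  have hR3sum : ∑ q ∈ ((Finset.Icc 1 Q).filter Squarefree).filter (fun q => ¬ ∀ p ∈ q.primeFactors, p ≤ w),
      condAvg q w a b₀ (fun b => |e q b|) ≤ C * (gscale w a b₀ * (2 * s)) := by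
    calc ∑ q ∈ ((Finset.Icc 1 Q).filter Squarefree).filter (fun q => ¬ ∀ p ∈ q.primeFactors, p ≤ w),
          condAvg q w a b₀ (fun b => |e q b|)
        ≤ ∑ q ∈ ((Finset.Icc 1 Q).filter Squarefree).filter (fun q => ¬ ∀ p ∈ q.primeFactors, p ≤ w),
            C * wprod (Nat.gcd q (primorial w)) a b₀ *
              ∏ p ∈ (q / Nat.gcd q (primorial w)).primeFactors, (K / (p : ℝ) ^ 2) :=
          Finset.sum_le_sum fun q hq =>
            condAvg_abs_le_of_decay hC.le ha hLw' htw hdec (hmemS q hq).1 (hmemS q hq).2 b₀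
      _ = C * ∑ q ∈ ((Finset.Icc 1 Q).filter Squarefree).filter (fun q => ¬ ∀ p ∈ q.primeFactors, p ≤ w),
            wprod (Nat.gcd q (primorial w)) a b₀ *
              ∏ p ∈ (q / Nat.gcd q (primorial w)).primeFactors, (K / (p : ℝ) ^ 2) := by
          rw [Finset.mul_sum]; exact Finset.sum_congr rfl fun q _ => by ring
      _ ≤ C * (gscale w a b₀ * (2 * s)) := mul_le_mul_of_nonneg_left hSn_mean hC.le
  have hR2sum : ∑ q ∈ ((Finset.Icc 1 Q).filter Squarefree).filter (fun q => ¬ ∀ p ∈ q.primeFactors, p ≤ w),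
      |condAvg q w a b₀ (e q)| ≤ C * (gscale w a b₀ * (2 * s)) :=
    le_trans (Finset.sum_le_sum fun q _ => abs_condAvg_le q w a b₀ (e q)) hR3sum
  have hR1sum : ∑ q ∈ ((Finset.Icc 1 Q).filter Squarefree).filter (fun q => ¬ ∀ p ∈ q.primeFactors, p ≤ w),
      |e q b₀| ≤ C * (gscale w a b₀ * (2 * s)) := by
    calc ∑ q ∈ ((Finset.Icc 1 Q).filter Squarefree).filter (fun q => ¬ ∀ p ∈ q.primeFactors, p ≤ w), |e q b₀|
        ≤ ∑ q ∈ ((Finset.Icc 1 Q).filter Squarefree).filter (fun q => ¬ ∀ p ∈ q.primeFactors, p ≤ w),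
            C * (wprod (Nat.gcd q (primorial w)) a b₀ * wprod (q / Nat.gcd q (primorial w)) a b₀) :=
          Finset.sum_le_sum fun q hq => abs_le_of_decay_split w hdec (hmemS q hq).1 (hmemS q hq).2 b₀
      _ = C * ∑ q ∈ ((Finset.Icc 1 Q).filter Squarefree).filter (fun q => ¬ ∀ p ∈ q.primeFactors, p ≤ w),
            wprod (Nat.gcd q (primorial w)) a b₀ * wprod (q / Nat.gcd q (primorial w)) a b₀ := by
          rw [Finset.mul_sum]
      _ ≤ C * (gscale w a b₀ * (2 * s)) := mul_le_mul_of_nonneg_left hSn_wt hC.le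
  -- the smooth sum of `|e q b₀|` is at most `C G_w`
  have hSm_sum : ∑ q ∈ ((Finset.Icc 1 Q).filter Squarefree).filter (fun q => ∀ p ∈ q.primeFactors, p ≤ w),
      |e q b₀| ≤ C * gscale w a b₀ := by
    have hmem : ∀ q ∈ ((Finset.Icc 1 Q).filter Squarefree).filter (fun q => ∀ p ∈ q.primeFactors, p ≤ w),
        1 ≤ q ∧ Squarefree q ∧ ∀ p ∈ q.primeFactors, p ≤ w := fun q hq => by
      rw [Finset.mem_filter, Finset.mem_filter, Finset.mem_Icc] at hq
      exact ⟨hq.1.1.1, hq.1.2, hq.2⟩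
    calc ∑ q ∈ ((Finset.Icc 1 Q).filter Squarefree).filter (fun q => ∀ p ∈ q.primeFactors, p ≤ w), |e q b₀|
        ≤ ∑ q ∈ ((Finset.Icc 1 Q).filter Squarefree).filter (fun q => ∀ p ∈ q.primeFactors, p ≤ w),
            C * wprod q a b₀ := Finset.sum_le_sum fun q hq => hdec q (hmem q hq).2.1 b₀
      _ = C * ∑ q ∈ ((Finset.Icc 1 Q).filter Squarefree).filter (fun q => ∀ p ∈ q.primeFactors, p ≤ w),
            wprod q a b₀ := by rw [Finset.mul_sum]
      _ ≤ C * ∑ d ∈ (primorial w).divisors, wprod d a b₀ := by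
          refine mul_le_mul_of_nonneg_left ?_ hC.le
          refine Finset.sum_le_sum_of_subset_of_nonneg (fun q hq => ?_) (fun d _ _ => wprod_nonneg d a b₀)
          obtain ⟨hq1, hq2, hq3⟩ := hmem q hq
          exact Nat.mem_divisors.2 ⟨dvd_primorial_of_smooth hq1 hq2 hq3, (primorial_pos w).ne'⟩
      _ = C * gscale w a b₀ := by rw [hG]
  -- numerical consequences of the choice of `s`
  have hκG : C * (gscale w a b₀ * (2 * s)) ≤ κ * gscale w a b₀ := by
    have h1 : C * (2 * s) ≤ κ := by nlinarith [hs0.le, hC.le]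
    calc C * (gscale w a b₀ * (2 * s)) = (C * (2 * s)) * gscale w a b₀ := by ring
      _ ≤ κ * gscale w a b₀ := mul_le_mul_of_nonneg_right h1 hG0
  have hκ3 : C * gscale w a b₀ + C * (gscale w a b₀ * (2 * s)) ≤ (1 + κ) * C * gscale w a b₀ := by
    have h1 : 2 * s ≤ κ := by nlinarith [hs0.le, hC.le]
    have h2 : C * (gscale w a b₀ * (2 * s)) ≤ C * (gscale w a b₀ * κ) :=
      mul_le_mul_of_nonneg_left (mul_le_mul_of_nonneg_left h1 hG0) hC.le
    nlinarith
  refine ⟨?_, ?_, ?_⟩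
  · -- (R1)
    rw [sfBand_sub_smoothBand Q w e b₀]
    exact ((Finset.abs_sum_le_sum_abs _ _).trans hR1sum).trans hκG
  · -- (R2)
    rw [condSum_sub_smoothBand Q w hinv b₀]
    exact ((Finset.abs_sum_le_sum_abs _ _).trans hR2sum).trans hκG
  · -- (R3)
    rw [sum_condAvg_abs_split Q w hinv b₀]
    exact (add_le_add hSm_sum hR3sum).trans hκ3

end RigidityProof

/-- **`stub_typeRigidity`** (registered stub of the reshaped line `gallagher-backwards-split`): TYPE RIGIDITY —
pointwise values of a type-invariant spectrum with Hardy–Littlewood decay are controlled by its type-conditioned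
density ((R1) smooth truncation of the band sum, (R2) the conditioned density is the same smooth part, (R3) the
conditioned absolute mass), uniformly in the level. Replaces the FALSE `IncidenceRigidity` of the original line. -/
theorem stub_typeRigidity : TypeRigidity :=
  RigidityProof.typeRigidity_holds

end Summit.Parity.GeneralizedHardyLittlewood.Cruxes.RelativeDimOne.TypeSplit

end
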